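import Mathlib.RingTheory.DedekindDomain.FiniteAdeleRing
import Literature.NumberTheory.DiophantineGeometry.GenEllBDClasses
import Literature.NumberTheory.DiophantineGeometry.GenEllProjLine
import Literature.NumberTheory.DiophantineGeometry.GenEllNorthcott
import Literature.IUT.LogVolume.ArakelovDivisors
import HarnessLib

/-!
# [IUTchIV] Corollary 2.2 (Construction of Suitable Initial Θ-Data) — STATEMENT over the [GenEll]
# vocabulary of the `λ`-line, and the bookkeeping step of the proof of Corollary 2.3

Mochizuki, *Inter-universal Teichmüller theory IV*, RIMS manuscript (Apr. 2020; = PRIMS **57** (2021)),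
Cor. 2.2, statement pp. 41–43; Cor. 2.3, proof pp. 54–55. This file TYPES Cor. 2.2 as `Prop`s (it is
part of the disputed chain: Cor. 2.2 (ii) applies Theorem 1.10, which rests on [IUTchIII] Cor. 3.12 —
nothing is asserted) over the tree's [GenEll] §1 vocabulary for `X = ℙ¹_ℚ` (the "`λ`-line"),
`D = {0, 1, ∞}` (`Literature.NumberTheory.DiophantineGeometry.GenEll`: presented points `NFPoint`,
`UPle d = U_X(Q̄)^{≤d}`, `NFPoint.ht = ht_{ω_X(D)}`, `logDiff`, `logCond`, compactly bounded subsets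
`CBData`, BD-relations `BDLe`/`BDEquiv`), and PROVES the bookkeeping by which the proof of Cor. 2.3
(p. 55) turns Cor. 2.2 (i), (ii) [condition (C2)], (iii) into the inequality of BD-classes
`ht_{ω_X(D)} ≲ (1+ε)(log-diff_X + log-cond_D)` on `K_V ∩ U_X(Q̄)^{≤d}` — i.e. into statement (ii) of
[GenEll] Thm. 2.1 for this `K_V` (`bdLe_of_corollary22`); the remaining step of Cor. 2.3, "(ii) ⟹ (i)"
of [GenEll] Thm. 2.1 (noncritical Belyi maps), is a cited result handled elsewhere (abc-iut-S4).

## Modelling decisions (read before the declarations)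

* **The functions `log(q^∀(−))`, `log(q^{∤2}(−))` of (i)** ("the normalized degree of the effective
  arithmetic divisor determined by the `q`-parameters of an elliptic curve over a number field at
  arbitrary nonarchimedean primes (resp. primes that do not divide 2)", p. 41; in the proof, p. 44:
  "`h := log(q^∀) = (1/[F:ℚ])·Σ_v h_v·f_v·log(p_v)` … `h_v ∈ ℕ_{≥1}` is the local height of `E_F` [cf.
  [GenEll], Definition 3.3]"). For the Legendre curve `y² = x(x−1)(x−λ)` the `j`-invariant is
  `j(λ) = 2^8·(λ²−λ+1)³/(λ²(λ−1)²)`; by Tate's theory `E` has potentially multiplicative reduction at a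
  finite place `v` iff `ord_v(j) < 0`, and then the local height (the order of the `q`-parameter, [GenEll]
  Def. 3.3, divided by the ramification index as in [GenEll] Rem. 3.3.1) is `−ord_v(j)`. We therefore
  DEFINE the local height at `v` of the point `λ` as `max(0, −ord_v(j(λ)))` (`localHeight`), and
  `log(q^S(λ)) := deĝ̲_F(Σ_{v ∤ S} localHeight_v·[v])` (normalized Arakelov degree, base-change invariant,
  so computable over the field presenting the point) — a real definition whose agreement with the printed
  "q-parameter divisor" is the classical fact just quoted (Silverman, AEC VII.5 / C.14), recorded here,
  not proved here.
* **`log(q)` of Theorem 1.10** for the initial Θ-data built in the proof ((P5), p. 46: "`𝕍^bad_mod` …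
  the nonarchimedean valuations … that do not divide `2l` and at which `E_F` has bad multiplicative
  reduction") is `log(q^{∤{2,l}}(λ))` (`logQAvoid P {2, l}`).
* **`ht_∞`** ("the normalized height … determined by the pull-back to `X` of the divisor at infinity of
  `(M̄_ell)_ℚ`", well-defined up to BD-equivalence): the pull-back of `[∞]` along `j : X → (M̄_ell)_ℚ ≅ ℙ¹_j`
  is `j^*[∞]`, so `ht_∞ ≈ ht_{[∞]} ∘ j`, and we take the representative `(1/[F:ℚ])·h(j(λ))` (normalized
  logarithmic Weil height of `j(λ)`, Mathlib `Height.logHeight₁`) — `htInfty`.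
* **(∗^{j-inv})** ("the image of `K_2` … via the `j`-invariant … is a bounded subset of `ℚ̄_2`", p. 41):
  `JInvBounded`.
* (ii) quantifies over "an elliptic curve `E_F` over a number field `F`" with `F = F_mod(√−1, E_{F_mod}[2·
  3·5])`; its conclusions (C1), (C2) concern only invariants of the point `x_E ∈ U_X(F_tpd)`, where
  `F_tpd = F_mod(E_{F_mod}[2]) = ℚ(λ_E)` is the minimal field of definition of `x_E` (p. 43: "`log-diff_X(x_E)
  = log(𝔡^{F_tpd})`"), plus the prime `l` of the constructed initial Θ-data. We type the CONCLUSIONS for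
  points `P ∈ K_V ∩ U_X(Q̄)^{≤d}` presented over their minimal field (as `UPle` requires), with `∃ l`; the
  clause "`E_F` and `F_mod` arise as the “`E_F`” and “`F_mod`” for a collection of initial Θ-data as in
  Theorem 1.10" is NOT typed here (it needs [IUTchI] Def. 3.1, layer L5) — flagged `TODO(L5)` below.

Deliberately NOT here: the proof of Cor. 2.2 (its arithmetic core is `Corollary22Arithmetic.lean`; the
rest needs [GenEll] §3, Prop. 1.8, Prop. 2.1); [GenEll] Thm. 2.1 itself; general hyperbolic curves.
-/

noncomputable section

namespace Literature.IUT.LogVolume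

namespace Cor22

open NumberField IsDedekindDomain Literature.NumberTheory.DiophantineGeometry.GenEll

/-! ## The functions of Corollary 2.2 (i) on points of the `λ`-line -/

/-- The `j`-invariant of the Legendre curve `y² = x(x−1)(x−λ)`: `j(λ) = 2^8·(λ² − λ + 1)³/(λ²·(λ − 1)²)`
("we shall regard the standard coordinate on `X = ℙ¹_ℚ` as the “`λ`” in the Legendre form … and hence
as being equipped with a natural classifying morphism `U_X → (M_ell)_ℚ`", p. 41; the formula is
Silverman, AEC III.1.7). Junk value at `λ ∈ {0, 1}` (division by zero), never used: all points below lie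
in `U_X`. [claim: Mochizuki2012, status: disputed] -/
def jInv {F : Type*} [Field F] (t : F) : F := 2 ^ 8 * (t ^ 2 - t + 1) ^ 3 / (t ^ 2 * (t - 1) ^ 2)

/-- The local height of the point `λ ∈ U_X(F)` at a finite place `v` of `F`: `max(0, −ord_v(j(λ)))` — the
order of the `q`-parameter of `y² = x(x−1)(x−λ)` at `v` when `v` is a place of potentially multiplicative
reduction (`ord_v(j) < 0`; Tate), and `0` otherwise ([GenEll] Def. 3.3 with Rem. 3.3.1; [IUTchIV] p. 44:
"`h_v = 0` for those `v` at which `E_F` has good reduction; `h_v ∈ ℕ_{≥1}` is the local height of `E_F` …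
for those `v` at which `E_F` has bad multiplicative reduction"). See the module docstring for this
modelling decision. [claim: Mochizuki2012, status: disputed] -/
def localHeight (P : NFPoint) (v : HeightOneSpectrum (𝓞 P.F)) : ℝ :=
  ((-(ord P.F v (jInv P.x))).toNat : ℝ)

/-- The local height is `≥ 0`. [claim: Mochizuki2012, status: disputed] -/
theorem localHeight_nonneg (P : NFPoint) (v : HeightOneSpectrum (𝓞 P.F)) : 0 ≤ localHeight P v := by
  unfold localHeight; positivity

/-- The (finite) set of finite places of `F` at which `j(λ)` has a pole, i.e. is non-integral
(Mathlib's `HeightOneSpectrum.Support`, finite by `Support.finite`): the places of potentially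
multiplicative reduction. [claim: Mochizuki2012, status: disputed] -/
def badPlaces (P : NFPoint) : Finset (HeightOneSpectrum (𝓞 P.F)) :=
  (HeightOneSpectrum.Support.finite (R := 𝓞 P.F) (jInv P.x)).toFinset

open scoped Classical in
/-- The effective arithmetic divisor "determined by the `q`-parameters" of the curve `λ` AWAY from the
rational primes in `S`: `Σ_{v bad, v ∤ S} h_v·[v]` (p. 41 (i): `S = ∅` for `q^∀`, `S = {2}` for `q^{∤2}`;
p. 46 (P5): `S = {2, l}` for the `log(q)` of the constructed initial Θ-data). [claim: Mochizuki2012, status: disputed] -/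
def qDivisor (P : NFPoint) (S : Finset ℕ) : FinDivisor P.F :=
  ∑ v ∈ (badPlaces P).filter (fun v => ∀ p ∈ S, ((p : ℕ) : 𝓞 P.F) ∉ v.asIdeal),
    FinDivisor.of v (localHeight P v)

/-- `log(q^{∤S}(λ))` := the normalized degree `deĝ̲` of the `q`-parameter divisor away from `S`
(p. 41 (i): "obtained by forming the normalized degree “`deg(−)`” of the effective arithmetic divisor
determined by the `q`-parameters"). [claim: Mochizuki2012, status: disputed] -/
def logQAvoid (P : NFPoint) (S : Finset ℕ) : ℝ := FinDivisor.ndeg P.F (qDivisor P S)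

/-- `log(q^∀(x))` (p. 41 (i): at arbitrary nonarchimedean primes).
[claim: Mochizuki2012, status: disputed] -/
def logQForall (P : NFPoint) : ℝ := logQAvoid P ∅

/-- `log(q^{∤2}(x))` (p. 41 (i): at the nonarchimedean primes that do not divide `2`).
[claim: Mochizuki2012, status: disputed] -/
def logQNotTwo (P : NFPoint) : ℝ := logQAvoid P {2}

/-- A representative of `ht_∞` (p. 41 (i)): the normalized logarithmic Weil height of `j(λ)`,
`(1/[F:ℚ])·h_F(j(λ))` (the divisor at infinity of `(M̄_ell)_ℚ` pulls back to `j^*[∞]`; see the module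
docstring). [claim: Mochizuki2012, status: disputed] -/
def htInfty (P : NFPoint) : ℝ := (P.degree : ℝ)⁻¹ * Height.logHeight₁ (jInv P.x)

/-- `log(q^{∤S}) ≥ 0` (an effective divisor). [claim: Mochizuki2012, status: disputed] -/
theorem logQAvoid_nonneg (P : NFPoint) (S : Finset ℕ) : 0 ≤ logQAvoid P S := by
  classical
  unfold logQAvoid qDivisor
  apply FinDivisor.ndeg_nonneg
  intro v
  rw [Finset.sum_apply']
  exact Finset.sum_nonneg fun w _ => by
    unfold FinDivisor.of
    rw [Finsupp.single_apply]
    split_ifs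
    · exact localHeight_nonneg P w
    · exact le_rfl

/-- `log(q^{∤T}) ≤ log(q^{∤S})` for `S ⊆ T`: removing more primes from an effective divisor lowers its degree.
In particular the first two inequalities of (C2), "`(1/6)·log(q) ≤ (1/6)·log(q^{∤2}) ≤ (1/6)·log(q^∀)`"
(p. 42), hold by construction (`conditionC2_first_two`). [claim: Mochizuki2012, status: disputed] -/
theorem logQAvoid_anti (P : NFPoint) {S T : Finset ℕ} (hST : S ⊆ T) : logQAvoid P T ≤ logQAvoid P S := by
  classical
  unfold logQAvoid qDivisor
  rw [FinDivisor.ndeg_apply, FinDivisor.ndeg_apply, map_sum, map_sum]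
  apply div_le_div_of_nonneg_right _ FinDivisor.finrank_pos.le
  apply Finset.sum_le_sum_of_subset_of_nonneg
  · intro v hv
    rw [Finset.mem_filter] at hv ⊢
    exact ⟨hv.1, fun p hp => hv.2 p (hST hp)⟩
  · intro v _ _
    rw [FinDivisor.deg_of]
    exact mul_nonneg (localHeight_nonneg P v) (logNorm_pos P.F v).le

/-- The first two inequalities of condition (C2) of Cor. 2.2 (ii) (p. 42), `(1/6)·log(q) ≤ (1/6)·log(q^{∤2})
≤ (1/6)·log(q^∀)` with `log(q) = log(q^{∤{2,l}})`, PROVED from the definitions.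
[claim: Mochizuki2012, status: disputed] -/
theorem conditionC2_first_two (P : NFPoint) (l : ℕ) :
    1 / 6 * logQAvoid P {2, l} ≤ 1 / 6 * logQNotTwo P ∧ 1 / 6 * logQNotTwo P ≤ 1 / 6 * logQForall P := by
  have h1 : logQAvoid P {2, l} ≤ logQNotTwo P :=
    logQAvoid_anti P (Finset.singleton_subset_iff.mpr (Finset.mem_insert_self 2 {l}))
  have h2 : logQNotTwo P ≤ logQForall P := logQAvoid_anti P (Finset.empty_subset _)
  constructor <;> linarith

/-! ## The hypotheses on `K_V` -/

/-- Condition (∗^{j-inv}) on `K_V` (p. 41): "If `v ∈ 𝕍(ℚ)` denotes the nonarchimedean prime “2”, then the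
image of the subset `K_v ⊆ U_X(ℚ̄_v)` … via the `j`-invariant … is a bounded subset of `𝔸¹_ℚ(ℚ̄_v) =
ℚ̄_v`, i.e., is contained in a subset of the form `2^{N_{j-inv}}·O_{ℚ̄_v}`". [claim: Mochizuki2012, status: disputed] -/
def JInvBounded (D : CBData) : Prop := ∃ C : ℝ, ∀ y ∈ D.Knon 2, ‖jInv y‖ ≤ C

/-- The hypotheses of Cor. 2.2 on the compactly bounded subset `K_V ⊆ U_X(ℚ̄)`: "whose support contains the
nonarchimedean prime “2”" and (∗^{j-inv}) (p. 41). [claim: Mochizuki2012, status: disputed] -/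
structure Hypotheses (D : CBData) : Prop where
  /-- the support of `K_V` contains `2` -/
  supp : D.SupportContains {2}
  /-- (∗^{j-inv}) -/
  jinv : JInvBounded D

/-! ## Corollary 2.2 (i), (ii), (iii) as `Prop`s -/

/-- **Cor. 2.2 (i)** (p. 41): "we have an equality of “bounded discrepancy classes” `(1/6)·log(q^{∤2}(−)) ≈
(1/6)·log(q^∀(−)) ≈ (1/6)·ht_∞ ≈ ht_{ω_X(D)}` of functions on `K_V ⊆ U_X(ℚ̄)`."
[claim: Mochizuki2012, status: disputed] -/
def PartI (D : CBData) : Prop :=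
  BDEquiv D.toSet (fun P => 1 / 6 * logQNotTwo P) (fun P => 1 / 6 * logQForall P) ∧
  BDEquiv D.toSet (fun P => 1 / 6 * logQForall P) (fun P => 1 / 6 * htInfty P) ∧
  BDEquiv D.toSet (fun P => 1 / 6 * htInfty P) NFPoint.ht

/-- `δ := 2^12·3^3·5·d` (p. 42 (ii)). [claim: Mochizuki2012, status: disputed] -/
def delta (d : ℕ) : ℝ := 2 ^ 12 * 3 ^ 3 * 5 * (d : ℝ)

/-- `ε_E := (60δ)²·log(2δ·log(q^∀))/(log(q^∀))^{1/2}` (p. 42, "so `ε_E` depends on the integer `d`, as well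
as on the elliptic curve `E_F`!"). [claim: Mochizuki2012, status: disputed] -/
def epsilonE (d : ℕ) (P : NFPoint) : ℝ :=
  (60 * delta d) ^ 2 * Real.log (2 * delta d * logQForall P) / Real.sqrt (logQForall P)

/-- Conditions (C1), (C2) of Cor. 2.2 (ii) (p. 42) for the point `x_E` (presented over `F_tpd = ℚ(λ_E)`)
with the prime `l` of the constructed initial Θ-data and the constant `C_K`:
"(C1) `(log(q^∀))^{1/2} ≤ l ≤ 10δ·(log(q^∀))^{1/2}·log(2δ·log(q^∀))`;
(C2) `(1/6)·log(q) ≤ (1/6)·log(q^{∤2}) ≤ (1/6)·log(q^∀) ≤ (1 + ε_E)·(log-diff_X(x_E) + log-cond_D(x_E)) + C_K`",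
where `log(q) = log(q^{∤{2,l}})` (p. 46 (P5)). [claim: Mochizuki2012, status: disputed] -/
def ConditionsC1C2 (d : ℕ) (CK : ℝ) (P : NFPoint) (l : ℕ) : Prop :=
  Real.sqrt (logQForall P) ≤ l ∧
    (l : ℝ) ≤ 10 * delta d * Real.sqrt (logQForall P) * Real.log (2 * delta d * logQForall P) ∧
  1 / 6 * logQAvoid P {2, l} ≤ 1 / 6 * logQNotTwo P ∧ 1 / 6 * logQNotTwo P ≤ 1 / 6 * logQForall P ∧
    1 / 6 * logQForall P ≤ (1 + epsilonE d P) * (P.logDiff + P.logCond) + CK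

/-- **Cor. 2.2 (ii)** (pp. 41–43) for `K_V`, with the uniform constant `H_unif`: "there exist … positive real
numbers `C_K` and `H_K` which depend only on the choice of … `K_V` such that …: Let `d` be a positive
integer, `ε_d` a positive real number `≤ 1` … Then there exists a finite subset `Exc_d ⊆ U_X(ℚ̄)^{≤d}` which
depends only on `K_V`, `d`, and `ε_d`, contains all points corresponding to elliptic curves that admit
automorphisms of order `> 2`, and satisfies …: The function `log(q^∀(−))` … is `≤ H_unif·ε_d^{−3}·d^{4+ε_d} +
H_K` on `Exc_d`. Let `E_F` be an elliptic curve … `x_E ∈ K_V`, `x_E ∉ Exc_d` … Then `E_F` and `F_mod`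
arise as the “`E_F`” and “`F_mod`” for a collection of initial Θ-data as in Theorem 1.10 [TODO(L5): this
clause needs [IUTchI] Def. 3.1 and is not typed here] that … satisfies (C1), (C2)" — typed as: for every
`P ∈ K_V ∩ U_X(ℚ̄)^{≤d} ∖ Exc_d` there is a prime `l ≥ 5` with (C1), (C2). (Points with `j ∈ {0, 1728}`
are "contained in" `Exc_d` — recorded as the membership clause for `j(λ) = 0, 1728`.) "Finite subset
`Exc_d ⊆ U_X(ℚ̄)^{≤d}`" is counted through minimal polynomials (`HasFinitelyManyPoints`), since a `ℚ̄`-point has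
many presentations `(F, x)` in the tree's model. [claim: Mochizuki2012, status: disputed] -/
def PartII (D : CBData) (Hunif : ℝ) : Prop :=
  ∃ CK HK : ℝ, 0 < CK ∧ 0 < HK ∧
    ∀ d : ℕ, 1 ≤ d → ∀ εd : ℝ, 0 < εd → εd ≤ 1 →
      ∃ Exc : Set NFPoint, HasFinitelyManyPoints Exc ∧ Exc ⊆ UPle d ∧
        (∀ P ∈ D.toSet ∩ UPle d, (jInv P.x = 0 ∨ jInv P.x = 1728) → P ∈ Exc) ∧
        (∀ P ∈ Exc, logQForall P ≤ Hunif * εd ^ (-(3 : ℝ)) * (d : ℝ) ^ (4 + εd) + HK) ∧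
        ∀ P ∈ D.toSet ∩ UPle d, P ∉ Exc →
          ∃ l : ℕ, l.Prime ∧ 5 ≤ l ∧ ConditionsC1C2 d CK P l

/-- **Cor. 2.2 (iii)** (p. 43): "`H_unif` … may be chosen in such a way that …: Let `d` be a positive integer,
`ε_d` and `ε` positive real numbers `≤ 1`. Then there exists a finite subset `Exc_{ε,d} ⊆ U_X(ℚ̄)^{≤d}` which
depends only on `K_V`, `ε`, `d`, and `ε_d` such that … `log(q^∀(−))` … is `≤ H_unif·ε^{−3}·ε_d^{−3}·d^{4+ε_d} +
H_K` on `Exc_{ε,d}`, and … `ε_E ≤ ε` whenever … `x_E ∉ Exc_{ε,d}`." Finiteness of the exceptional set of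
`ℚ̄`-points is counted through minimal polynomials (`HasFinitelyManyPoints`, [GenEll] Ex. 1.3 (i) file), since a
`ℚ̄`-point has many presentations `(F, x)`. [claim: Mochizuki2012, status: disputed] -/
def PartIII (D : CBData) (Hunif : ℝ) : Prop :=
  ∃ HK : ℝ, 0 < HK ∧
    ∀ d : ℕ, 1 ≤ d → ∀ εd : ℝ, 0 < εd → εd ≤ 1 → ∀ ε : ℝ, 0 < ε → ε ≤ 1 →
      ∃ Exc : Set NFPoint, HasFinitelyManyPoints Exc ∧ Exc ⊆ UPle d ∧
        (∀ P ∈ Exc, logQForall P ≤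
          Hunif * ε ^ (-(3 : ℝ)) * εd ^ (-(3 : ℝ)) * (d : ℝ) ^ (4 + εd) + HK) ∧
        ∀ P ∈ D.toSet ∩ UPle d, P ∉ Exc → epsilonE d P ≤ ε

/-- **[IUTchIV] Corollary 2.2** (pp. 41–43), for a given uniform constant `H_unif > 0` ("independent of
`K_V`"): for every compactly bounded `K_V ⊆ U_X(ℚ̄)` whose support contains `2` and which satisfies
(∗^{j-inv}), (i), (ii), (iii) hold. The corollary itself is `∃ H_unif, Corollary22 H_unif` (a predicate here,
so that no closed disputed statement sits in `Literature/`). Part of the disputed chain (its proof applies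
Theorem 1.10): typed, never asserted. [claim: Mochizuki2012, status: disputed] -/
def Corollary22 (Hunif : ℝ) : Prop :=
  0 < Hunif ∧ ∀ D : CBData, Hypotheses D → PartI D ∧ PartII D Hunif ∧ PartIII D Hunif

/-! ## The bookkeeping of the proof of Corollary 2.3 (p. 55) -/

-- `log-diff_X(x) ≥ 0`, `log-cond_D(x) ≥ 0`: `NFPoint.logDiff_nonneg`, `NFPoint.logCond_nonneg` (tree,
-- `GenEllNorthcott.lean`).

/-- **The proof of Cor. 2.3, its Cor. 2.2 step (p. 55)**: "it suffices to show that the inequality of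
BD-classes … `ht_{ω_X(D)} ≲ (1+ε)(log-diff_X + log-cond_D)` holds on `K_V ∩ U_X(ℚ̄)^{≤d}`. But such an
inequality follows immediately, in light of the [relevant] equality of BD-classes of Corollary 2.2, (i),
from Corollary 2.2, (ii) [cf. condition (C2)], (iii)". PROVED here as bookkeeping: (i) + (ii) + (iii) for
`K_V` give, for every `d ≥ 1` and `ε > 0`, `ht ≲ (1+ε)(log-diff + log-cond)` on `K_V ∩ U_X(ℚ̄)^{≤d}` — i.e.
hypothesis (ii) of [GenEll] Thm. 2.1 for this `K_V` (finite exceptional sets are absorbed by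
`bdLe_diff_finite_iff`). [claim: Mochizuki2012, status: disputed] -/
theorem bdLe_of_corollary22 {D : CBData} {Hunif : ℝ} (hI : PartI D) (hII : PartII D Hunif)
    (hIII : PartIII D Hunif) {d : ℕ} (hd : 1 ≤ d) {ε : ℝ} (hε : 0 < ε) :
    BDLe (D.toSet ∩ UPle d) NFPoint.ht (fun P => (1 + ε) * (P.logDiff + P.logCond)) := by
  obtain ⟨CK, HK, hCKpos, _, hII⟩ := hII
  obtain ⟨HK₃, _, hIII⟩ := hIII
  -- exceptional sets for `ε_d := 1` and `ε' := min ε 1`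
  set ε' : ℝ := min ε 1 with hε'
  have hε'0 : 0 < ε' := lt_min hε one_pos
  have hε'1 : ε' ≤ 1 := min_le_right _ _
  have hε'ε : ε' ≤ ε := min_le_left _ _
  obtain ⟨Exc₁, -, -, -, hB₁, hC⟩ := hII d hd 1 one_pos le_rfl
  obtain ⟨Exc₂, -, -, hB₂, hE⟩ := hIII d hd 1 one_pos le_rfl ε' hε'0 hε'1
  -- from (i): `ht ≤ (1/6) log(q^∀) + C₀` on `K_V`
  obtain ⟨_, h12, h23⟩ := hI
  have hht : BDLe D.toSet NFPoint.ht (fun P => 1 / 6 * logQForall P) :=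
    (h23.symm.trans h12.symm).bdLe
  obtain ⟨C₀, hC₀⟩ := hht
  -- the bounds for `log(q^∀)` ON the exceptional sets, and the printed chain OFF them
  set B₁ : ℝ := Hunif * (1 : ℝ) ^ (-(3 : ℝ)) * (d : ℝ) ^ (4 + (1 : ℝ)) + HK with hB₁def
  set B₂ : ℝ := Hunif * ε' ^ (-(3 : ℝ)) * (1 : ℝ) ^ (-(3 : ℝ)) * (d : ℝ) ^ (4 + (1 : ℝ)) + HK₃ with hB₂def
  refine ⟨C₀ + CK + (|B₁| + |B₂|) / 6, fun P hP => ?_⟩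
  obtain ⟨hPD, hPd⟩ := hP
  have h0 := hC₀ P hPD
  have hLC : 0 ≤ P.logDiff + P.logCond := add_nonneg P.logDiff_nonneg P.logCond_nonneg
  have hε1 : 0 ≤ (1 + ε) * (P.logDiff + P.logCond) := mul_nonneg (by linarith) hLC
  have hCK : 0 ≤ CK := le_of_lt hCKpos
  have hA₁ : B₁ ≤ |B₁| := le_abs_self _
  have hA₂ : B₂ ≤ |B₂| := le_abs_self _
  have hA₁' : 0 ≤ |B₁| := abs_nonneg _
  have hA₂' : 0 ≤ |B₂| := abs_nonneg _
  simp only at h0 ⊢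
  by_cases hP1 : P ∈ Exc₁
  · have hq : logQForall P ≤ B₁ := hB₁ P hP1
    linarith
  by_cases hP2 : P ∈ Exc₂
  · have hq : logQForall P ≤ B₂ := hB₂ P hP2
    linarith
  obtain ⟨l, -, -, -, -, -, -, hC2⟩ := hC P ⟨hPD, hPd⟩ hP1
  have hεE : epsilonE d P ≤ ε' := hE P ⟨hPD, hPd⟩ hP2
  have hmono : (1 + epsilonE d P) * (P.logDiff + P.logCond) ≤ (1 + ε) * (P.logDiff + P.logCond) :=
    mul_le_mul_of_nonneg_right (by linarith) hLC
  linarith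

end Cor22

end Literature.IUT.LogVolume

end
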